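import Literature.AlgebraicGeometry.Morphisms.CechModuleExactH0
import Literature.AlgebraicGeometry.Morphisms.CechModuleShortExact
import Literature.AlgebraicGeometry.Morphisms.CechModuleUnit
import Literature.AlgebraicGeometry.Modules.SheafHomExact
import Summits.HodgeConjecture.HodgeConjecture.Theorems.PadicSemiregularLiftPadicPridhamSemiregularityClosedImmersionModules
import Summits.HodgeConjecture.HodgeConjecture.Theorems.PadicSemiregularLiftFormalVectorBundlesAlgebraizeLadderCore
import Mathlib.CategoryTheory.Adjunction.Mates

/-!
# Tools for lifting morphisms along a tower of reductions (support for EB1)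

Support lemmas for stub EB1 (`stub_towerPresentation`) of line `chow-zariski-pushforward` of the crux
`FormalVectorBundlesAlgebraize` (route `PadicSemiregularLift` of `HodgeConjecture`):

* morphisms over the whole scheme: `V ⟶ M` is the same as `V|_⊤ ⟶ M|_⊤` (`exists_hom_of_over_top`,
  `hom_eq_of_overFunctor_top_map_eq`);
* Čech bookkeeping: `Ȟ¹` of an isomorphism is injective; naturality of `Ȟ⁰(𝒰, M) ≅ Γ(X, M)`;
* **lifting** (`exists_comp_eq_of_shortExact`): for `0 → Q → G' → G → 0` short exact, `V` finite
  locally free with `𝓗om(V, Q)` affine-localizing and `Ȟ¹(𝒰, 𝓗om(V, Q)) = 0` on an affine cover `𝒰`,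
  every `V ⟶ G` lifts to `V ⟶ G'` (long exact Čech sequence of `0 → 𝓗om(V,Q) → 𝓗om(V,G') → 𝓗om(V,G) → 0`);
* **nilpotent Nakayama** (`epi_of_comp_eq_of_locally`): if `g : G' ⟶ G` is locally surjective with
  kernel `a·`, `a²` kills `G'`, `v : V ↠ G` and `w ≫ g = v`, then `w` is an epimorphism;
* **transposition along a restriction** (`transpose_restrict`): the transpose of `f^* ã ≫ s` along the
  pseudofunctoriality isomorphism `f^* g^* ≅ (f ≫ g)^* ≅ g'^*`, and epimorphy of transposes for closed
  immersions (`epi_homEquiv_symm_of_epi`).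

Everything is proved; no definitions.
-/

noncomputable section

-- Summit.HodgeConjecture.HodgeConjecture.… repeats the summit name by the D-0017 layout (Sub = Summit).
set_option linter.dupNamespace false
-- `(𝟭 _).obj`, `(F ⋙ G).obj`, `TopCat.Presheaf` are not reducible (as in Mathlib's `AlgebraicGeometry/Modules`).
set_option backward.isDefEq.respectTransparency false

open CategoryTheory CategoryTheory.Limits AlgebraicGeometry TopologicalSpace Opposite
open Literature.AlgebraicGeometry.Motives Literature.AlgebraicGeometry.Modules
open Literature.AlgebraicGeometry.Morphisms
open Summit.HodgeConjecture.HodgeConjecture.Theorems.PadicPridhamSemiregularity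

universe u

namespace Summit.HodgeConjecture.HodgeConjecture.Theorems.FormalVectorBundlesAlgebraize

variable {X : Scheme.{u}}

/-! ### Morphisms over the whole scheme -/

section OverTop

variable {V M : X.Modules}

/-- **Every morphism `V|_⊤ ⟶ M|_⊤` comes from a morphism `V ⟶ M`** (its values on the opens). -/
theorem exists_hom_of_over_top (ψ : V.over ⊤ ⟶ M.over ⊤) :
    ∃ w : V ⟶ M, (SheafOfModules.overFunctor _ ⊤).map w = ψ := by
  let φ : V.presheaf ⟶ M.presheaf :=
    { app := fun U => AddCommGrpCat.ofHom
        { toFun := fun s => appLE ψ (homOfLE (le_top : U.unop ≤ ⊤)) s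
          map_zero' := appLE_zero_right ψ _
          map_add' := fun s t => appLE_add_right ψ _ s t }
      naturality := fun {U U'} i => by
        ext s
        change appLE ψ (homOfLE (le_top : U'.unop ≤ ⊤)) (V.presheaf.map i s) =
          M.presheaf.map i (appLE ψ (homOfLE (le_top : U.unop ≤ ⊤)) s)
        rw [show i = i.unop.op from rfl, appLE_congr_hom ψ (homOfLE le_top) (i.unop ≫ homOfLE le_top),
          appLE_map] }
  refine ⟨⟨PresheafOfModules.homMk φ fun U r s => appLE_smul_right ψ (homOfLE le_top) r s⟩,
    hom_ext_of_appLE fun W k s => ?_⟩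
  rw [appLE_over_map, appLE_congr_hom ψ k (homOfLE le_top)]
  rfl

/-- Morphisms with the same restriction to `⊤` are equal. -/
theorem hom_eq_of_overFunctor_top_map_eq {a b : V ⟶ M}
    (h : (SheafOfModules.overFunctor _ ⊤).map a = (SheafOfModules.overFunctor _ ⊤).map b) : a = b := by
  refine Scheme.Modules.hom_ext _ _ fun W => ?_
  ext s
  rw [← appLE_over_map a (homOfLE (le_top : W ≤ ⊤)) s, h, appLE_over_map]

end OverTop

/-! ### Čech bookkeeping -/

section Cech

variable {A : Type u} [CommRing A] (f : X ⟶ Spec (.of A)) {ι : Type u} (U : ι → X.Opens)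

/-- `Ȟ¹(𝒰, 𝟙) = id`. -/
theorem cechMapH1_id {M : X.Modules} (x : CechMH1 f M U) : cechMapH1 f (𝟙 M) U x = x := by
  obtain ⟨z, rfl⟩ := CechMH1.mk_surjective f M U x
  rw [cechMapH1_mk]
  congr 1

/-- `Ȟ¹` of an isomorphism is injective. -/
theorem cechMapH1_injective_of_iso {M N : X.Modules} (e : M ≅ N) :
    Function.Injective (cechMapH1 f e.hom U) := by
  intro x y hxy
  have h := congrArg (cechMapH1 f e.inv U) hxy
  rwa [← cechMapH1_comp, ← cechMapH1_comp, e.hom_inv_id, cechMapH1_id, cechMapH1_id] at h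

/-- If `Ȟ¹(𝒰, N)` is trivial and `M ≅ N` then `Ȟ¹(𝒰, M)` is trivial. -/
theorem subsingleton_cechMH1_of_iso {M N : X.Modules} (e : M ≅ N)
    (h : Subsingleton (CechMH1 f N U)) : Subsingleton (CechMH1 f M U) :=
  (cechMapH1_injective_of_iso f U e).subsingleton

/-- **Naturality of `Ȟ⁰(𝒰, M) ≅ Γ(X, M)`** in the module `M`. -/
theorem cechMH0EquivSections_symm_cechMapH0 (hU : ⨆ i, U i = ⊤) {M N : X.Modules} (φ : M ⟶ N)
    (b : cechMH0 f M U) :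
    (cechMH0EquivSections f U N hU).symm (cechMapH0 f φ U b) =
      MSections.app f φ ⊤ ((cechMH0EquivSections f U M hU).symm b) := by
  apply (cechMH0EquivSections f U N hU).injective
  rw [LinearEquiv.apply_symm_apply]
  apply Subtype.ext
  funext i
  rw [cechMapH0_coe, cechMapC0_apply]
  conv_lhs => rw [← (cechMH0EquivSections f U M hU).apply_symm_apply b]
  change MSections.app f φ (U i) (MSections.res f M le_top _) = MSections.res f N le_top _
  rw [MSections.res_app]

end Cech

/-! ### Lifting morphisms along a short exact sequence with `Ȟ¹ = 0` -/

section Lift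

variable {A : Type u} [CommRing A] (f : X ⟶ Spec (.of A)) {ι : Type u} (U : ι → X.Opens)

/-- **Lifting.** Let `0 → Q —j→ G' —g→ G → 0` be short exact, `V` finite locally free with `𝓗om(V, Q)`
affine-localizing and `Ȟ¹(𝒰, 𝓗om(V, Q))` trivial for an affine open cover `𝒰` of `X`. Then every
`v : V ⟶ G` lifts: `w ≫ g = v` for some `w : V ⟶ G'` (long exact Čech sequence of the short exact
sequence `0 → 𝓗om(V, Q) → 𝓗om(V, G') → 𝓗om(V, G) → 0`, tree `exists_cechMapH0_eq_of_cechDelta_eq_zero`). -/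
theorem exists_comp_eq_of_shortExact (hUaff : ∀ i, IsAffineOpen (U i)) (hUcov : ⨆ i, U i = ⊤)
    {V Q G' G : X.Modules} (hV : IsFiniteLocallyFree V) (j : Q ⟶ G') (g : G' ⟶ G) (w : j ≫ g = 0)
    (hS : (ShortComplex.mk j g w).ShortExact) (hQ : IsAffineLocalizing (sheafHom V Q))
    (hH1 : Subsingleton (CechMH1 f (sheafHom V Q) U)) (v : V ⟶ G) :
    ∃ w' : V ⟶ G', w' ≫ g = v := by
  haveI := preservesFiniteColimits_sheafHomFunctor V hV
  let S' := (ShortComplex.mk j g w).map (sheafHomFunctor V)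
  have hS' : S'.ShortExact := hS.map_of_exact (sheafHomFunctor V)
  have hdata : CechExactData f U S'.f S'.g := CechExactData.of_shortExact f U hS' hQ hUaff
  -- `v` as a `0`-cocycle of `𝓗om(V, G) = S'.X₃`
  let vt : MSections f S'.X₃ ⊤ := ((SheafOfModules.overFunctor _ ⊤).map v : V.over ⊤ ⟶ G.over ⊤)
  let b'' : cechMH0 f S'.X₃ U := cechMH0EquivSections f U S'.X₃ hUcov vt
  have hδ : hdata.cechDelta b'' = 0 := @Subsingleton.elim _ hH1 _ _
  obtain ⟨b, hb⟩ := hdata.exists_cechMapH0_eq_of_cechDelta_eq_zero b'' hδ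
  -- the lift, as a morphism `V|_⊤ ⟶ G'|_⊤`
  let ψ : V.over ⊤ ⟶ G'.over ⊤ := (cechMH0EquivSections f U S'.X₂ hUcov).symm b
  have hψ : ψ ≫ (SheafOfModules.overFunctor _ ⊤).map g = (SheafOfModules.overFunctor _ ⊤).map v := by
    have h := cechMH0EquivSections_symm_cechMapH0 f U hUcov S'.g b
    rw [hb, LinearEquiv.symm_apply_apply] at h
    exact h.symm
  obtain ⟨w', hw'⟩ := exists_hom_of_over_top ψ
  exact ⟨w', hom_eq_of_overFunctor_top_map_eq (by rw [Functor.map_comp, hw', hψ])⟩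

end Lift

/-! ### Nilpotent Nakayama for a locally surjective reduction -/

section Nakayama

variable {V G' G : X.Modules}

/-- **Nilpotent Nakayama.** Let `g : G' ⟶ G` be, near every point, surjective with kernel `a·` on the
affine opens, let `a²` kill the sections of `G'`, let `v : V ⟶ G` be an epimorphism and
`w ≫ g = v`. Then `w` is an epimorphism: locally a section `y` of `G'` is `w(s₁) + a y₁`, and
`y₁ = w(s₂) + a y₂`, so `y = w(s₁ + a s₂) + a² y₂ = w(s₁ + a s₂)`. -/
theorem epi_of_comp_eq_of_locally (g : G' ⟶ G) (a : ℕ)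
    (hg : ∀ x : X, ∃ U' : X.Opens, x ∈ U' ∧ ∀ W : X.Opens, IsAffineOpen W → W ≤ U' →
      Function.Surjective (g.app W) ∧ ∀ y : Γ(G', W), g.app W y = 0 ↔ ∃ y', y = a • y')
    (hkill : ∀ (W : X.Opens) (y : Γ(G', W)), (a * a) • y = 0) (v : V ⟶ G) [Epi v] (w : V ⟶ G')
    (hw : w ≫ g = v) : Epi w := by
  -- one correction step: near `x`, `y = w(s) + a y'` on a smaller affine
  have step : ∀ (W : X.Opens) (y : Γ(G', W)) (x : X), x ∈ W → ∃ (W' : X.Opens) (hW' : W' ≤ W),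
      x ∈ W' ∧ ∃ (s : Γ(V, W')) (y' : Γ(G', W')),
        G'.presheaf.map (homOfLE hW').op y = w.app W' s + a • y' := by
    intro W y x hx
    obtain ⟨U', hxU', hU'⟩ := hg x
    obtain ⟨W₁, hW₁W, hxW₁, s₁, hs₁⟩ := Scheme.Modules.exists_app_eq_of_epi v W (g.app W y) x hx
    obtain ⟨W₂, hW₂aff, hxW₂, hW₂W₁, hW₂U'⟩ := exists_affine_nhds_le W₁ hxW₁ U' hxU'
    have h0 : g.app W₂ (G'.presheaf.map (homOfLE (hW₂W₁.trans hW₁W)).op y -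
        w.app W₂ (V.presheaf.map (homOfLE hW₂W₁).op s₁)) = 0 := by
      rw [map_sub, Scheme.Modules.Hom.app_map_apply, ← comp_app_apply, hw,
        Scheme.Modules.Hom.app_map_apply, hs₁, presheaf_map_map, homOfLE_comp, sub_self]
    obtain ⟨y', hy'⟩ := ((hU' W₂ hW₂aff hW₂U').2 _).mp h0
    exact ⟨W₂, hW₂W₁.trans hW₁W, hxW₂, V.presheaf.map (homOfLE hW₂W₁).op s₁, y',
      by rw [← hy', add_sub_cancel]⟩
  -- local surjectivity of `w`
  have hls : TopCat.Presheaf.IsLocallySurjective w.mapPresheaf := by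
    rw [TopCat.Presheaf.isLocallySurjective_iff]
    intro W y x hx
    obtain ⟨W₁, hW₁, hx₁, s₁, y₁, h₁⟩ := step W y x hx
    obtain ⟨W₂, hW₂, hx₂, s₂, y₂, h₂⟩ := step W₁ y₁ x hx₁
    refine ⟨W₂, hW₂.trans hW₁, ⟨V.presheaf.map (homOfLE hW₂).op s₁ + a • s₂, ?_⟩, hx₂⟩
    change w.app W₂ _ = G'.presheaf.map (homOfLE (hW₂.trans hW₁)).op y
    conv_rhs => rw [← homOfLE_comp hW₂ hW₁, ← presheaf_map_map G' (homOfLE hW₁) (homOfLE hW₂) y, h₁,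
      map_add, map_nsmul, h₂, ← Scheme.Modules.Hom.app_map_apply, smul_add, ← mul_smul, hkill, add_zero]
    rw [map_add, map_nsmul]
  have h1 : Epi ((SheafOfModules.toSheaf X.ringCatSheaf).map w) :=
    (TopCat.Sheaf.isLocallySurjective_iff_epi _).mp hls
  have h2 := (SheafOfModules.toSheaf X.ringCatSheaf).epi_of_epi_map h1
  exact ⟨fun _ _ hh => (@cancel_epi _ _ _ _ _ _ h2 _ _).mp hh⟩

end Nakayama

/-! ### Transposition along a restriction -/

section Transpose

variable {X' Y Z' : Scheme.{u}} (f : X' ⟶ Y) (g : Y ⟶ Z')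

/-- The hom-equivalence of `(f ≫ g)^* ⊣ (f ≫ g)_*` across Mathlib's `pullbackComp`
(`conjugateEquiv_pullbackComp_inv`: the conjugate of `pullbackComp⁻¹` is `pushforwardComp`). -/
theorem homEquiv_pullbackComp_inv_comp (M : Z'.Modules) (P : X'.Modules)
    (φ : (Scheme.Modules.pullback f).obj ((Scheme.Modules.pullback g).obj M) ⟶ P) :
    (Scheme.Modules.pullbackPushforwardAdjunction (f ≫ g)).homEquiv M P
        ((Scheme.Modules.pullbackComp f g).inv.app M ≫ φ) =
      (Scheme.Modules.pullbackPushforwardAdjunction g).homEquiv M _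
        ((Scheme.Modules.pullbackPushforwardAdjunction f).homEquiv _ P φ) ≫
          (Scheme.Modules.pushforwardComp f g).hom.app P := by
  have h1 : (Scheme.Modules.pullbackPushforwardAdjunction g).homEquiv M _
      ((Scheme.Modules.pullbackPushforwardAdjunction f).homEquiv _ P φ) =
      ((Scheme.Modules.pullbackPushforwardAdjunction g).comp
        (Scheme.Modules.pullbackPushforwardAdjunction f)).homEquiv M P φ := by
    rw [Adjunction.comp_homEquiv]
    rfl
  rw [h1, Adjunction.homEquiv_unit, Adjunction.homEquiv_unit, Functor.map_comp,
    ← Scheme.Modules.conjugateEquiv_pullbackComp_inv]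
  have h2 : ((Scheme.Modules.pullbackPushforwardAdjunction (f ≫ g)).unit.app M :
      M ⟶ (Scheme.Modules.pushforward (f ≫ g)).obj ((Scheme.Modules.pullback (f ≫ g)).obj M)) ≫
        (Scheme.Modules.pushforward (f ≫ g)).map ((Scheme.Modules.pullbackComp f g).inv.app M) =
      ((Scheme.Modules.pullbackPushforwardAdjunction g).comp
        (Scheme.Modules.pullbackPushforwardAdjunction f)).unit.app M ≫
        (conjugateEquiv ((Scheme.Modules.pullbackPushforwardAdjunction g).comp
          (Scheme.Modules.pullbackPushforwardAdjunction f))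
          (Scheme.Modules.pullbackPushforwardAdjunction (f ≫ g)) (Scheme.Modules.pullbackComp f g).inv).app _ :=
    (unit_conjugateEquiv ((Scheme.Modules.pullbackPushforwardAdjunction g).comp
      (Scheme.Modules.pullbackPushforwardAdjunction f))
      (Scheme.Modules.pullbackPushforwardAdjunction (f ≫ g)) (Scheme.Modules.pullbackComp f g).inv M).symm
  dsimp only [Functor.comp_obj, Functor.id_obj] at h2 ⊢
  rw [reassoc_of% h2, Category.assoc]
  congr 1
  exact ((conjugateEquiv _ _ (Scheme.Modules.pullbackComp f g).inv).naturality φ).symm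

/-- **Transposition along a restriction.** For `a : M ⟶ g_* N` (transpose `ã : g^* M ⟶ N`),
`s : f^* N ⟶ P` and `b : M ⟶ g'_* P` with `g' = f ≫ g` (up to `h`) and
`b = a ≫ g_*(η_f ≫ f_* s) ≫ (g_* f_* ≅ g'_*)`: `f^* ã ≫ s = (f^* g^* M ≅ g'^* M) ≫ b̃`. -/
theorem transpose_restrict {g' : X' ⟶ Z'} (h : f ≫ g = g') (M : Z'.Modules) (N : Y.Modules)
    (P : X'.Modules) (a : M ⟶ (Scheme.Modules.pushforward g).obj N)
    (s : (Scheme.Modules.pullback f).obj N ⟶ P) (b : M ⟶ (Scheme.Modules.pushforward g').obj P)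
    (hb : b = a ≫ (Scheme.Modules.pushforward g).map
      ((Scheme.Modules.pullbackPushforwardAdjunction f).unit.app N ≫ (Scheme.Modules.pushforward f).map s) ≫
        (Scheme.Modules.pushforwardComp f g).hom.app P ≫ (Scheme.Modules.pushforwardCongr h).hom.app P) :
    (Scheme.Modules.pullback f).map (((Scheme.Modules.pullbackPushforwardAdjunction g).homEquiv M N).symm a) ≫
        s =
      ((Scheme.Modules.pullbackComp f g).app M ≪≫ (Scheme.Modules.pullbackCongr h).app M).hom ≫
        ((Scheme.Modules.pullbackPushforwardAdjunction g').homEquiv M P).symm b := by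
  subst h
  have hc : (Scheme.Modules.pushforwardCongr (rfl : f ≫ g = f ≫ g)).hom.app P = 𝟙 _ := by
    refine Scheme.Modules.hom_ext _ _ fun U => ?_
    rw [Scheme.Modules.pushforwardCongr_hom_app_app, eqToHom_op, eqToHom_refl]
    exact P.presheaf.map_id _
  rw [hc, Category.comp_id] at hb
  have key : (Scheme.Modules.pullbackPushforwardAdjunction (f ≫ g)).homEquiv M P
      ((Scheme.Modules.pullbackComp f g).inv.app M ≫ (Scheme.Modules.pullback f).map
        (((Scheme.Modules.pullbackPushforwardAdjunction g).homEquiv M N).symm a) ≫ s) = b := by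
    rw [homEquiv_pullbackComp_inv_comp, hb, Adjunction.homEquiv_naturality_left,
      (Scheme.Modules.pullbackPushforwardAdjunction f).homEquiv_unit,
      Adjunction.homEquiv_naturality_right, Equiv.apply_symm_apply, Category.assoc]
  rw [← key, Equiv.symm_apply_apply, Iso.trans_hom, Iso.app_hom, Iso.app_hom, Category.assoc]
  have hc' : (Scheme.Modules.pullbackCongr (rfl : f ≫ g = f ≫ g)).hom.app M = 𝟙 _ := rfl
  rw [hc', Category.id_comp, Iso.hom_inv_id_app_assoc]

/-- The transpose `g^* V ⟶ F` of an epimorphism `V ↠ g_* F` is an epimorphism, for `g` a closed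
immersion (`g^*` is a left adjoint; the counit `g^* g_* F ⟶ F` is an isomorphism). -/
theorem epi_homEquiv_symm_of_epi [IsClosedImmersion g] {V : Z'.Modules} {F : Y.Modules}
    (v : V ⟶ (Scheme.Modules.pushforward g).obj F) [Epi v] :
    Epi (((Scheme.Modules.pullbackPushforwardAdjunction g).homEquiv V F).symm v) := by
  rw [Adjunction.homEquiv_counit]
  haveI := isIso_counit_app_of_isClosedImmersion g F
  exact epi_comp _ _

end Transpose

/-- **Registered sub-goal** (helper stub of `stub_towerPresentation`, universe `0`): the transpose of
an epimorphism onto the direct image along a closed immersion is an epimorphism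
(`epi_homEquiv_symm_of_epi`). -/
theorem stub_epiTransposeClosedImmersion :
    ∀ (X Y : AlgebraicGeometry.Scheme.{0}) (g : Y ⟶ X) [AlgebraicGeometry.IsClosedImmersion g]
      (V : X.Modules) (F : Y.Modules) (v : V ⟶ (AlgebraicGeometry.Scheme.Modules.pushforward g).obj F),
      CategoryTheory.Epi v →
        CategoryTheory.Epi (((AlgebraicGeometry.Scheme.Modules.pullbackPushforwardAdjunction g).homEquiv
          V F).symm v) :=
  fun _ _ g _ _ _ v _ => epi_homEquiv_symm_of_epi g v

end Summit.HodgeConjecture.HodgeConjecture.Theorems.FormalVectorBundlesAlgebraize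

end
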